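import Mathlib
import Summits.ResolutionOfSingularities.ResolutionOfSingularities.Theorems.PAlterationPicoverLocalModelLogRegularEndgameLocal

/-!
# Crux `PicoverLocalModel` (stmt-ResolutionOfSingularities-0557), line `SketchIdeator3`
# (giraud-cossart-normal-form) — endgame, step L2: the wound twist is the integral closure

**The wound twist is the integral closure of the model.** For a domain `O` of characteristic
`p`, `a = g^p + x_B^p · u` with `x_B ≠ 0` and the model `M = O[t]/(t^p - a)` a domain, the wound
twist `C = O[s]/(s^p - u)` embeds into `Frac M` by `x_B s ↦ t - g`
(`LogRegularEndgame.exists_algHom_adjoinRoot_wound_twist`, landed); if `C` is an integrally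
closed domain (e.g. a regular local ring: the wound and transversal exits), its image IS the
integral closure of `M` in `Frac M` (`range_woundTwist_eq_integralClosure`). The general
mechanism is `integralClosure_eq_range_of_isIntegrallyClosed`: an integrally closed domain `C`,
integral over `O`, embedded in the fraction field `K` of an integral `O`-algebra `A` so that its
image contains `A`, has image the integral closure of `A` in `K`.
-/

noncomputable section

-- single-problem summit: the doubled namespace component `ResolutionOfSingularities` is the tree layout
set_option linter.dupNamespace false

open Polynomial

namespace Summit.ResolutionOfSingularities.ResolutionOfSingularities.Theorems.PicoverLocalModel.WoundTwistIntegralClosure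

/-- **An integrally closed intermediate order is the integral closure.** Let `O → A → K` be a
tower with `K` a fraction field of `A` and `A` integral over `O`, and let `φ : C → K` be an
injective `O`-algebra map from an integrally closed domain `C`, integral over `O`, whose image
contains the image of `A`. Then the image of `φ` is (the underlying subring of) the integral
closure of `A` in `K`: it consists of integral elements, and an element of `K` integral over `A`
is integral over the subring `φ(C) ≅ C`, of which `K` is a fraction field, hence lies in it.
[folklore] -/
theorem integralClosure_eq_range_of_isIntegrallyClosed : ∀ {O A C K : Type*} [CommRing O] [CommRing A] [CommRing C] [IsDomain C] [IsIntegrallyClosed C] [Field K] [Algebra O A] [Algebra A K] [Algebra O K] [IsScalarTower O A K] [IsFractionRing A K] [Algebra.IsIntegral O A] [Algebra O C] [Algebra.IsIntegral O C] (φ : C →ₐ[O] K), Function.Injective φ → (algebraMap A K).range ≤ φ.toRingHom.range → (integralClosure A K).toSubring = φ.toRingHom.range := by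
  intro O A C K _ _ _ _ _ _ _ _ _ _ _ _ _ _ φ hφ hA
  ext z
  constructor
  · intro hz
    change IsIntegral A z at hz
    -- `z` is integral over `O`, hence over the subring `S = φ(C)`
    have hzO : IsIntegral O z := isIntegral_trans z hz
    set S : Subring K := φ.toRingHom.range
    letI : Algebra O S := (φ.toRingHom.rangeRestrict.comp (algebraMap O C)).toAlgebra
    haveI : IsScalarTower O S K := IsScalarTower.of_algebraMap_eq fun x => by
      change algebraMap O K x = φ (algebraMap O C x)
      rw [AlgHom.commutes]
    have hzS : IsIntegral S z := hzO.tower_top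
    -- `S ≅ C` is an integrally closed domain with fraction field `K`
    have e : C ≃+* S := RingEquiv.ofBijective φ.toRingHom.rangeRestrict
      ⟨fun x y hxy => hφ (congrArg Subtype.val hxy), φ.toRingHom.rangeRestrict_surjective⟩
    haveI : IsDomain S := e.symm.toMulEquiv.isDomain
    haveI : IsIntegrallyClosed S := IsIntegrallyClosed.of_equiv e
    haveI : FaithfulSMul S K := (faithfulSMul_iff_algebraMap_injective S K).mpr
      Subtype.val_injective
    haveI : IsFractionRing S K := by
      refine IsFractionRing.of_field S K fun w => ?_
      obtain ⟨x, y, -, rfl⟩ := IsFractionRing.div_surjective (A := A) w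
      exact ⟨⟨_, hA ⟨x, rfl⟩⟩, ⟨_, hA ⟨y, rfl⟩⟩, rfl⟩
    obtain ⟨y, hy⟩ := (isIntegrallyClosed_iff K).mp inferInstance hzS
    rw [← hy]
    exact y.2
  · rintro ⟨c, rfl⟩
    exact ((Algebra.IsIntegral.isIntegral (R := O) c).map φ).tower_top

/-- **The wound twist is the integral closure of the model.** For a domain `O` of
characteristic `p`, `a = g^p + x_B^p · u` with `x_B ≠ 0`, the model `M = O[t]/(t^p - a)` a domain
and the wound twist `C = O[s]/(s^p - u)` an integrally closed domain (e.g. regular local — the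
wound exit `WoundExit.isRegularLocalRing_adjoinRoot_of_wound` and the transversal exit
`TransversalExit.isRegularLocalRing_adjoinRoot_of_transversal`), the injective `O`-algebra map
`φ : C → Frac M`, `x_B φ(s) = t - g` (`LogRegularEndgame.exists_algHom_adjoinRoot_wound_twist`)
has image exactly the integral closure of `M` in `Frac M`: the normalisation of the model over a
wound/transversal point is `O[t']/(t'^p - u)`, `t' = (t - g)/x_B` (Giraud 1983, Prop. 1.5;
step L2 of the endgame plan of line `SketchIdeator3`, stub `stub_localCharts`). [cite: Giraud1983, Prop. 1.5] -/
theorem range_woundTwist_eq_integralClosure : ∀ {O : Type*} [CommRing O] [IsDomain O] (p : ℕ) [Fact p.Prime] [CharP O p] (a g u xB : O), xB ≠ 0 → a = g ^ p + xB ^ p * u → ∀ [IsDomain (AdjoinRoot ((Polynomial.X : Polynomial O) ^ p - Polynomial.C a))] [IsDomain (AdjoinRoot ((Polynomial.X : Polynomial O) ^ p - Polynomial.C u))] [IsIntegrallyClosed (AdjoinRoot ((Polynomial.X : Polynomial O) ^ p - Polynomial.C u))], ∃ φ : AdjoinRoot ((Polynomial.X : Polynomial O) ^ p - Polynomial.C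 u) →ₐ[O] FractionRing (AdjoinRoot ((Polynomial.X : Polynomial O) ^ p - Polynomial.C a)), Function.Injective φ ∧ algebraMap O _ xB * φ (AdjoinRoot.root _) = algebraMap (AdjoinRoot ((Polynomial.X : Polynomial O) ^ p - Polynomial.C a)) _ (AdjoinRoot.root _) - algebraMap O _ g ∧ (integralClosure (AdjoinRoot ((Polynomial.X : Polynomial O) ^ p - Polynomial.C a)) (FractionRing (AdjoinRoot ((Polynomial.X : Polynomial O) ^ p - Polynomial.C a)))).toSubring = φ.toRingHom.range := by
  intro O _ _ p _ _ a g u xB hxB ha _ _ _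
  have hp : p ≠ 0 := (Fact.out : p.Prime).ne_zero
  obtain ⟨φ, hφinj, hφ⟩ := LogRegularEndgame.exists_algHom_adjoinRoot_wound_twist p a g u xB hxB ha
  obtain ⟨θ, hθ⟩ := LogRegularEndgame.exists_algHom_adjoinRoot_to_wound_twist p a g u xB ha
  have hcomp := LogRegularEndgame.algHom_comp_wound_twist p a g u xB θ φ hθ hφ
  haveI : Algebra.IsIntegral O (AdjoinRoot ((X : O[X]) ^ p - C a)) :=
    haveI := (monic_X_pow_sub_C a hp).finite_adjoinRoot; inferInstance
  haveI : Algebra.IsIntegral O (AdjoinRoot ((X : O[X]) ^ p - C u)) :=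
    haveI := (monic_X_pow_sub_C u hp).finite_adjoinRoot; inferInstance
  refine ⟨φ, hφinj, hφ, integralClosure_eq_range_of_isIntegrallyClosed φ hφinj ?_⟩
  rintro _ ⟨m, rfl⟩
  refine ⟨θ m, ?_⟩
  change φ (θ m) = _
  rw [← AlgHom.comp_apply, hcomp, IsScalarTower.toAlgHom_apply]

end Summit.ResolutionOfSingularities.ResolutionOfSingularities.Theorems.PicoverLocalModel.WoundTwistIntegralClosure

end
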